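import Literature.AlgebraicGeometry.Motives.IntegralModelReductionMap
import Literature.AlgebraicGeometry.Motives.ProperIntegralPointsFrobeniusTranslateScheme
import Literature.NumberTheory.DiophantineGeometry.AbelianSchemeModelReductionFrobenius
import Literature.NumberTheory.GaloisRepresentations.LocalGaloisGroupFrobeniusProofs
import HarnessLib

/-!
# A local arithmetic Frobenius reduces to the `q`-Frobenius: `red_𝒳 (σ • x) = F (red_𝒳 x)` for EVERY proper integral model
# ([SerreTate1968] §1 Lemma 2 «this isomorphism commutes with the action of `D(v̄)`»; [Shimura1998] §16.3 (1) «`(t^σ)~ = t̃^q`»)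

Topic `Literature/AlgebraicGeometry/Motives`, namespace `Literature.AlgebraicGeometry.Motives.IntegralModel`.  THEOREMS only (no def, no
instance, no notation, no named fact, no `sorry`).  Cell `hodgecm-mathlib` (D-0151), FLOOR 0, programme F0P5a (D9op road 2′, crux item
stmt-HodgeConjecture-24832): the CLOSER of the support letter **`FrobeniusLiftOnReduction`** (`stub_Fr`) of edition 4 of
`Cruxes/HLiu418/Lines/F0_D9opRoad2.lean` (F0P5a-p02 (g0) hand-back memo §1; A-p05 (g15) letters skeleton rf v0 :458), for the group-free reduction
map ★ `IntegralModel.geomReductionMap` (p793383) of a PROPER integral model `𝒳` of a `K`-scheme `X` at a finite place `v`: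

  there is `σ ∈ Γ_{K_v}` (any arithmetic Frobenius of the local field `K_v`, ★ `exists_isAbsArithFrob_holds`) such that for EVERY `X`, EVERY
  proper model `𝒳` and EVERY `x ∈ X(\overline{K_v})`:  `red_𝒳 (σ • x) = F (red_𝒳 x)`,  `F` the `q_v`-Frobenius of the special fibre `𝒳_v`
  on `κ̄(v)`-points (★ `frobeniusOver`).

Everything is by name.  The three layers of `red_𝒳 = reductionPoint ∘ (ι_κ ≫ extendPoint) ∘ modelPointsEquiv⁻¹` are `Γ_{K_v}`-equivariant:
`modelPointsEquiv` (adjunction `Over.map ⊣ Over.pullback` + the model's `genericIso`, ★ `specFractionFieldIso_inv_comp_specFractionFieldMap`;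
`modelPointsEquiv_specFractionFieldMap_comp`), the plain reduction `ι_κ ≫ extendPoint` of ANY proper `𝓞ᵥ`-scheme (★
`specRingHomι_comp_extendPoint_specFractionFieldMap`, A-p03 (g16) p795656, uniqueness in the valuative criterion [Hartshorne1977] II.4.7), and
`reductionPoint` carries `Spec τ̄` for `τ̄ = (y ↦ y^q)` on `κ(R)` to the arithmetic Frobenius of `κ̄(v)/κ(v)` (★
`geomClosedPointIso_inv_comp_specResidueFieldMap_of_forall_eq_pow`, the Frobenius square on the geometric closed point), which acts on
`𝒳_v(κ̄(v))` as `F` (★ `arithFrob_smul_eq_map_frobeniusOver`, [Milne2025] V Cor. 2.6); an arithmetic Frobenius `τ` of `K_v` has `τ̄ = (y ↦ y^{q_v})`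
(★ `residueFieldMap_apply_eq_pow_of_isAbsArithFrob`, [NeukirchANT1999] I (9.4)).  The group version (abelian-scheme models, `red_v` a
homomorphism) is ★ `IsAbelianSchemeModel.specialFibreReductionHom_smul_of_isArithFrobAt`; here NO group structure is assumed (the smooth proper
model of the record CURVE).

HC_CM is proved only modulo the 7 printed citations until rung 0 closes; this file is a generic leaf and changes no count.

## Main statements
* `modelPointsEquiv_specFractionFieldMap_comp`, `modelPointsEquiv_symm_smul` — `Hom_{𝓞ᵥ}(Spec Ω, 𝒳) ≃ X(Ω)` is `Γ_{K_v}`-equivariant.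
* `reductionPoint_specResidueFieldMap_comp_of_forall_eq_pow` — `reductionPoint (Spec τ̄ ≫ y) = F (reductionPoint y)` when `τ̄ = (y ↦ y^{q_v})`.
* `geomReductionMap_smul` — `red_𝒳 (σ • x) = reductionPoint (σ • (ι_κ ≫ extendPoint …))` for every `σ ∈ Γ_{K_v}` (equivariance).
* `geomReductionMap_smul_of_isAbsArithFrob` — `red_𝒳 (τ • x) = F (red_𝒳 x)` for an arithmetic Frobenius `τ`.
* **`exists_forall_geomReductionMap_smul_eq_map_frobeniusOver`** — the letter `FrobeniusLiftOnReduction` with its binders.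

## References
* [SerreTate1968] J.-P. Serre, J. Tate, *Good reduction of abelian varieties*, Ann. of Math. 88 (1968), §1 Lemma 2.
* [Shimura1998] G. Shimura, *Abelian Varieties with Complex Multiplication and Modular Functions*, §16.3 (1), §19.4 (19.4a).
* [Hartshorne1977] R. Hartshorne, *Algebraic Geometry*, II.4.7 (valuative criterion), IV Rem. 2.4.1.
* [NeukirchANT1999] J. Neukirch, *Algebraic Number Theory*, Ch. I §9 (9.4).
* [Milne2025] J. S. Milne, *Lectures on Étale Cohomology*, V Cor. 2.6 (proof).
-/

set_option autoImplicit false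

noncomputable section

open CategoryTheory _root_.AlgebraicGeometry IsDedekindDomain IsDedekindDomain.HeightOneSpectrum IsLocalRing Field
open scoped NumberField
open Literature.NumberTheory.EllipticCurves (genericFibre specGenericPoint)
open Literature.NumberTheory.GaloisRepresentations (closureValuationSubring closureValuationSubringMap residueFieldMap IsAbsArithFrob
  exists_isAbsArithFrob_holds residueFieldMap_apply_eq_pow_of_isAbsArithFrob)
open Literature.NumberTheory.DiophantineGeometry

namespace Literature.AlgebraicGeometry.Motives

namespace IntegralModel

variable {K : Type} [Field K] [NumberField K] {v : HeightOneSpectrum (𝓞 K)} {X : SchemeOver K}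

/-! ### `modelPointsEquiv` is `Γ_{K_v}`-equivariant -/

/-- **`Hom_{𝓞ᵥ}(Spec Ω, 𝒳) ≃ X(Ω)` is `Γ_{K_v}`-equivariant**: `e (Spec σ ≫ P) = σ • e P` for `σ ∈ Γ_{K_v}` (the group-free twin of ★
`IsAbelianSchemeModel.fractionFieldPointsEquiv_specFractionFieldMap_comp`: ★ `specFractionFieldIso_inv_comp_specFractionFieldMap`, naturality of
the adjunction in the source, and `σ • Q = Spec σ ≫ Q` on `X(Ω)`). [cite: SerreTate1968, §1 Lemma 2] [cite: Hartshorne1977, II.3 Thm. 3.3 (fibre product, universal property)] -/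
theorem modelPointsEquiv_specFractionFieldMap_comp (𝒳 : IntegralModel (valuationSubringAtPrime K v) K X)
    (σ : absoluteGaloisGroup (v.adicCompletion K))
    (P : specFractionField (closureValuationSubring (v.adicCompletion K)) (toClosureValuationSubring v) ⟶ 𝒳.total) :
    𝒳.modelPointsEquiv (specFractionFieldMap v σ ≫ P) = σ • 𝒳.modelPointsEquiv P := by
  rw [𝒳.modelPointsEquiv_apply, 𝒳.modelPointsEquiv_apply, ← Category.assoc, specFractionFieldIso_inv_comp_specFractionFieldMap,
    Category.assoc, Adjunction.homEquiv_naturality_left, Category.assoc]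
  rfl

/-- The inverse identification is equivariant: `e⁻¹ (σ • x) = Spec σ ≫ e⁻¹ x`. [cite: SerreTate1968, §1 Lemma 2] -/
theorem modelPointsEquiv_symm_smul (𝒳 : IntegralModel (valuationSubringAtPrime K v) K X) (σ : absoluteGaloisGroup (v.adicCompletion K))
    (x : AlgPoints X (AlgebraicClosure (v.adicCompletion K))) :
    𝒳.modelPointsEquiv.symm (σ • x) = specFractionFieldMap v σ ≫ 𝒳.modelPointsEquiv.symm x := by
  apply 𝒳.modelPointsEquiv.injective
  rw [Equiv.apply_symm_apply, modelPointsEquiv_specFractionFieldMap_comp, Equiv.apply_symm_apply]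

/-! ### `reductionPoint` carries `Spec (y ↦ y^q)` to the `q`-Frobenius -/

/-- **`reductionPoint (Spec τ̄ ≫ y) = F (reductionPoint y)`** when `τ ∈ Γ_{K_v}` induces `τ̄ = (y ↦ y ^ q_v)` on `κ(R)`, `q_v = #κ(v)`: under the
identifications `Spec κ(R) ≅ Spec κ̄(v)` the automorphism `Spec τ̄` is `Spec` of the arithmetic Frobenius `x ↦ x^{q_v}` of `κ̄(v)/κ(v)` (★
`geomClosedPointIso_inv_comp_specResidueFieldMap_of_forall_eq_pow`), the adjunction is natural in the source, and the arithmetic Frobenius acts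
on `κ̄(v)`-points of the `κ(v)`-scheme `𝒳_v` as the `q_v`-Frobenius `F` (★ `arithFrob_smul_eq_map_frobeniusOver`).
[cite: NeukirchANT1999, Ch. I §9 (9.4)] [cite: Milne2025, V Cor. 2.6 (proof, p. 197)] -/
theorem reductionPoint_specResidueFieldMap_comp_of_forall_eq_pow (𝒳 : IntegralModel (valuationSubringAtPrime K v) K X)
    {τ : absoluteGaloisGroup (v.adicCompletion K)} (hτ : ∀ y, residueFieldMap τ y = y ^ Nat.card v.asIdeal.ResidueField)
    (y : residueFieldPoints 𝒳.total) :
    𝒳.reductionPoint (specResidueFieldMap v τ ≫ y) = AlgPoints.map (frobeniusOver 𝒳.reductionAt) (𝒳.reductionPoint y) := by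
  have key : (geomClosedPointIso v).inv ≫ (geomClosedPointIsoSpecResidueField v).inv ≫ specResidueFieldMap v τ ≫ y =
      (Over.map (specResidueField v)).map
          (AlgPoints.specMap (absoluteGaloisGroup.toAlgEquiv v.asIdeal.ResidueField (arithFrob v.asIdeal.ResidueField))) ≫
        (geomClosedPointIso v).inv ≫ (geomClosedPointIsoSpecResidueField v).inv ≫ y := by
    have h := congrArg (· ≫ y) (geomClosedPointIso_inv_comp_specResidueFieldMap_of_forall_eq_pow v hτ)
    simpa only [Category.assoc] using h
  rw [← arithFrob_smul_eq_map_frobeniusOver, AlgPoints.absoluteGaloisGroup_smul_def, reductionPoint, reductionPoint, key,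
    Adjunction.homEquiv_naturality_left]
  rfl  -- `𝒳.reductionAt = (specialFibreFunctor v).obj 𝒳.total` (★ `specialFibreFunctor_obj_eq_reductionAt`, by `rfl`)

/-- The same with the action spelled `τ • y` (`residueFieldPoints`, `τ • y = Spec τ̄ ≫ y`). [cite: NeukirchANT1999, Ch. I §9 (9.4)] -/
theorem reductionPoint_smul_of_forall_eq_pow (𝒳 : IntegralModel (valuationSubringAtPrime K v) K X)
    {τ : absoluteGaloisGroup (v.adicCompletion K)} (hτ : ∀ y, residueFieldMap τ y = y ^ Nat.card v.asIdeal.ResidueField)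
    (y : residueFieldPoints 𝒳.total) :
    𝒳.reductionPoint (τ • y) = AlgPoints.map (frobeniusOver 𝒳.reductionAt) (𝒳.reductionPoint y) := by
  rw [residueFieldPoints.smul_def]
  exact 𝒳.reductionPoint_specResidueFieldMap_comp_of_forall_eq_pow hτ y

/-! ### The reduction map is `Γ_{K_v}`-equivariant; an arithmetic Frobenius reduces to `F` -/

/-- **`red_𝒳` is `Γ_{K_v}`-equivariant up to `reductionPoint`**: for a PROPER model and `σ ∈ Γ_{K_v}`,
`red_𝒳 (σ • x) = reductionPoint (σ • (ι_κ ≫ extendPoint (e⁻¹ x)))` — equivariance of `e⁻¹` (`modelPointsEquiv_symm_smul`) and of the plain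
reduction of any proper `𝓞ᵥ`-scheme (★ `specRingHomι_comp_extendPoint_specFractionFieldMap`, uniqueness in the valuative criterion).
[cite: SerreTate1968, §1 Lemma 2] [cite: Hartshorne1977, II.4.7] -/
theorem geomReductionMap_smul (𝒳 : IntegralModel (valuationSubringAtPrime K v) K X) [IsProper 𝒳.total.hom]
    (σ : absoluteGaloisGroup (v.adicCompletion K)) (x : AlgPoints X (AlgebraicClosure (v.adicCompletion K))) :
    𝒳.geomReductionMap (σ • x) = 𝒳.reductionPoint (σ •
      (specRingHomι (closureValuationSubring (v.adicCompletion K)) (toClosureValuationSubring v)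
          (residue (closureValuationSubring (v.adicCompletion K))) ≫
        extendPoint (closureValuationSubring (v.adicCompletion K)) (toClosureValuationSubring v) 𝒳.total (𝒳.modelPointsEquiv.symm x))) := by
  rw [geomReductionMap_def, modelPointsEquiv_symm_smul, specRingHomι_comp_extendPoint_specFractionFieldMap]

/-- **`red_𝒳 (τ • x) = F (red_𝒳 x)`** for a PROPER model `𝒳`, every `x ∈ X(\overline{K_v})` and every `τ ∈ Γ_{K_v}` with `τ̄ = (y ↦ y^{q_v})` on
`κ(R)`. [cite: SerreTate1968, §1 Lemma 2] [cite: Shimura1998, §16.3 (1) and §19.4 (19.4a)] -/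
theorem geomReductionMap_smul_of_forall_eq_pow (𝒳 : IntegralModel (valuationSubringAtPrime K v) K X) [IsProper 𝒳.total.hom]
    {τ : absoluteGaloisGroup (v.adicCompletion K)} (hτ : ∀ y, residueFieldMap τ y = y ^ Nat.card v.asIdeal.ResidueField)
    (x : AlgPoints X (AlgebraicClosure (v.adicCompletion K))) :
    𝒳.geomReductionMap (τ • x) = AlgPoints.map (frobeniusOver 𝒳.reductionAt) (𝒳.geomReductionMap x) := by
  rw [geomReductionMap_smul, 𝒳.reductionPoint_smul_of_forall_eq_pow hτ, ← geomReductionMap_def]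

/-- **An arithmetic Frobenius of `K_v` reduces to the `q_v`-Frobenius**: for `τ ∈ Γ_{K_v}` an arithmetic Frobenius (`IsAbsArithFrob τ`: `τ • x ≡ x^{q}`
modulo the maximal ideal of the absolute integers; then `τ̄ = (y ↦ y^{q_v})` on `κ(R)`, ★ `residueFieldMap_apply_eq_pow_of_isAbsArithFrob`, with
`q_v = #κ(v)` by ★ `residueFieldCard_adicCompletion_eq`, ★ `natCard_residueField`), a PROPER model `𝒳` and any `x ∈ X(\overline{K_v})`:
`red_𝒳 (τ • x) = F (red_𝒳 x)`. [cite: SerreTate1968, §1 Lemma 2] [cite: Shimura1998, §16.3 (1) and §19.4 (19.4a)] [cite: NeukirchANT1999, Ch. I §9 (9.4)] -/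
theorem geomReductionMap_smul_of_isAbsArithFrob (𝒳 : IntegralModel (valuationSubringAtPrime K v) K X) [IsProper 𝒳.total.hom]
    {τ : absoluteGaloisGroup (v.adicCompletion K)} (hτ : IsAbsArithFrob τ) (x : AlgPoints X (AlgebraicClosure (v.adicCompletion K))) :
    𝒳.geomReductionMap (τ • x) = AlgPoints.map (frobeniusOver 𝒳.reductionAt) (𝒳.geomReductionMap x) := by
  refine 𝒳.geomReductionMap_smul_of_forall_eq_pow (fun y => ?_) x
  rw [residueFieldMap_apply_eq_pow_of_isAbsArithFrob hτ, Literature.NumberTheory.Automorphic.residueFieldCard_adicCompletion_eq K v,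
    natCard_residueField v]

/-- Iterated form: `red_𝒳 (τⁿ • x) = Fⁿ (red_𝒳 x)`. [cite: SerreTate1968, §1 Lemma 2] -/
theorem geomReductionMap_pow_smul_of_isAbsArithFrob (𝒳 : IntegralModel (valuationSubringAtPrime K v) K X) [IsProper 𝒳.total.hom]
    {τ : absoluteGaloisGroup (v.adicCompletion K)} (hτ : IsAbsArithFrob τ) (n : ℕ) (x : AlgPoints X (AlgebraicClosure (v.adicCompletion K))) :
    𝒳.geomReductionMap (τ ^ n • x) = (AlgPoints.map (frobeniusOver 𝒳.reductionAt))^[n] (𝒳.geomReductionMap x) := by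
  induction n with
  | zero => rw [pow_zero, one_smul]; rfl
  | succ n ih => rw [pow_succ', mul_smul, 𝒳.geomReductionMap_smul_of_isAbsArithFrob hτ, ih, Function.iterate_succ_apply']

variable (K v) in
/-- **The letter `FrobeniusLiftOnReduction` (`stub_Fr` of `F0_D9opRoad2` ed. 4), with its binders**: there is `σ ∈ Γ_{K_v}` — any arithmetic
Frobenius of the local field `K_v` (★ `exists_isAbsArithFrob_holds`, [SerreLocalFields1979] Ch. I §8) — such that for EVERY `K`-scheme `X`, EVERY
proper integral model `𝒳` of `X` at `v` and EVERY `x ∈ X(\overline{K_v})`: `red_𝒳 (σ • x) = F (red_𝒳 x)`.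
[cite: SerreTate1968, §1 Lemma 2] [cite: Shimura1998, §16.3 (1) and §19.4 (19.4a)] -/
theorem exists_forall_geomReductionMap_smul_eq_map_frobeniusOver :
    ∃ σ : absoluteGaloisGroup (v.adicCompletion K),
      ∀ (X : SchemeOver K) (𝒳 : IntegralModel (valuationSubringAtPrime K v) K X) [IsProper 𝒳.total.hom]
        (x : AlgPoints X (AlgebraicClosure (v.adicCompletion K))),
        𝒳.geomReductionMap (σ • x) = AlgPoints.map (frobeniusOver 𝒳.reductionAt) (𝒳.geomReductionMap x) := by
  obtain ⟨τ, hτ⟩ : ∃ τ : absoluteGaloisGroup (v.adicCompletion K), IsAbsArithFrob τ := exists_isAbsArithFrob_holds _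
  exact ⟨τ, fun X 𝒳 _ x => 𝒳.geomReductionMap_smul_of_isAbsArithFrob hτ x⟩

variable (K v) in
/-- Variant recording the Frobenius property of the witness: `∃ σ`, `IsAbsArithFrob σ` AND the reduction identity for all proper models (so that
the same `σ` can be fed to other `IsAbsArithFrob`-consumers, e.g. ★ `IsAbelianSchemeModel.specialFibreGeomPoints_smul_eq_geomPointsMap_frobeniusHom`).
[cite: SerreTate1968, §1 Lemma 2] -/
theorem exists_isAbsArithFrob_forall_geomReductionMap_smul :
    ∃ σ : absoluteGaloisGroup (v.adicCompletion K), IsAbsArithFrob σ ∧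
      ∀ (X : SchemeOver K) (𝒳 : IntegralModel (valuationSubringAtPrime K v) K X) [IsProper 𝒳.total.hom]
        (x : AlgPoints X (AlgebraicClosure (v.adicCompletion K))),
        𝒳.geomReductionMap (σ • x) = AlgPoints.map (frobeniusOver 𝒳.reductionAt) (𝒳.geomReductionMap x) := by
  obtain ⟨τ, hτ⟩ : ∃ τ : absoluteGaloisGroup (v.adicCompletion K), IsAbsArithFrob τ := exists_isAbsArithFrob_holds _
  exact ⟨τ, hτ, fun X 𝒳 _ x => 𝒳.geomReductionMap_smul_of_isAbsArithFrob hτ x⟩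

end IntegralModel

end Literature.AlgebraicGeometry.Motives

end
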